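import Literature.NumberTheory.Automorphic.TateTruncatedZetaIntegral
import Literature.NumberTheory.Automorphic.TateTruncatedZetaIntegralTwisted
import Literature.NumberTheory.Automorphic.MeyerHplusStructure
import HarnessLib

/-!
# Tate's truncated zeta integral at `s = 1` for an arbitrary additive Haar measure on `𝔸_K`

Topic `NumberTheory/Automorphic`; namespace `Literature.NumberTheory.Automorphic`. THEOREMS ONLY
(no definition, no instance, no notation, no named fact, no `sorry`). `TateTruncatedZetaIntegral`
states Rogawski's Lemma 7.1.1 (b) [Rogawski1990, §7.1] for the SELF-DUAL Haar measure `μ` on `𝔸_K`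
(`μ(𝔸_K ⧸ K) = 1`, the normalisation in which Poisson summation has no constant). For an ARBITRARY
additive Haar measure `μ` the Fourier transform `𝔉_μ f = ∫ f ψ dμ` is `μ(D) · 𝔉_{μ₁} f` with
`μ₁ = μ(D)⁻¹ μ` self-dual (`D = adeleFundamentalDomain K`, `0 < μ(D) < ∞`), so the lemma holds with
`𝔉f` replaced by `μ(D)⁻¹ 𝔉_μ f` throughout — Tate's "unnormalised" form
[CasselsFrohlichANT1967, Ch. XV, remark after Thm. 4.2.1]:

  `∫_𝓕 (Σf(x) − ‖x‖⁻¹ 1_{‖x‖<T⁻¹} μ(D)⁻¹ 𝔉_μ f(0)) ‖x‖ dν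
     = V log T · μ(D)⁻¹ 𝔉_μ f(0) + A(f) + μ(D)⁻¹ ∫_{𝓕∩{‖x‖≥1}} Σ(𝔉_μ f) dν − V f(0)`.

* `measure_adeleFundamentalDomain_ne_zero` — `μ(D) ≠ 0` for a Haar measure;
* `adeleFourier_inv_smul` — `𝔉_{μ(D)⁻¹ μ} f = μ(D)⁻¹ • 𝔉_μ f`;
* **`integrableOn_and_setIntegral_tateTruncated_haar`** — the lemma for any Haar `μ`.

Cell `hodgecm-mathlib`, ENGINE T1 LAW 5 (L5-i) piece E (the consumer's `μ_{𝔸_E}` need not be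
normalised). HC_CM is proved only modulo the 7 printed citations until rung 0 closes — nothing here
bears on a summit statement.

## References
* [Rogawski1990] J. D. Rogawski, *Automorphic Representations of Unitary Groups in Three
  Variables*, Ann. of Math. Stud. 123 (1990), §7.1 Lemma 7.1.1.
* [CasselsFrohlichANT1967] J. Tate, *Fourier analysis in number fields and Hecke's
  zeta-functions*, in Cassels–Fröhlich (eds.), *Algebraic Number Theory* (1967), Ch. XV, Thm. 4.2.1
  and the remark following it; §4.4.
-/

set_option autoImplicit false

noncomputable section

open MeasureTheory MeasureTheory.Measure NumberField IsDedekindDomain Set Filter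
open scoped ENNReal NNReal
open Literature.NumberTheory.Automorphic.Meyer

namespace Literature.NumberTheory.Automorphic

variable {K : Type} [Field K] [NumberField K]
  [MeasurableSpace (AdeleRing (𝓞 K) K)] [BorelSpace (AdeleRing (𝓞 K) K)]
  (μ : Measure (AdeleRing (𝓞 K) K)) [μ.IsAddHaarMeasure]

/-- **`μ(D) ≠ 0`** for an additive Haar measure `μ` on `𝔸_K` and Tate's fundamental domain `D`
(the translates `ξ + D`, `ξ ∈ K`, cover `𝔸_K`). [cite: CasselsFrohlichANT1967, Ch. XV Thm. 4.1.3] -/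
theorem measure_adeleFundamentalDomain_ne_zero : μ (adeleFundamentalDomain K) ≠ 0 := by
  haveI : Countable (AdeleRing.principalSubgroup (𝓞 K) K) := by
    haveI := countable_numberField K
    exact (principalSubgroupEquiv K).countable_iff.1 inferInstance
  exact (isAddFundamentalDomain_adeleFundamentalDomain K μ).measure_ne_zero
    (NeZero.ne μ)

/-- `μ(D)` is finite and non-zero: `0 < μ(D).toReal`. [cite: CasselsFrohlichANT1967, Ch. XV Thm. 4.1.3] -/
theorem measure_adeleFundamentalDomain_toReal_pos : 0 < (μ (adeleFundamentalDomain K)).toReal :=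
  ENNReal.toReal_pos (measure_adeleFundamentalDomain_ne_zero μ)
    (measure_adeleFundamentalDomain_lt_top K μ).ne

/-- **Normalising the Haar measure**: `μ₁ = μ(D)⁻¹ • μ` is an additive Haar measure with
`μ₁(D) = 1` (the self-dual normalisation). [cite: CasselsFrohlichANT1967, Ch. XV Thm. 4.2.1] -/
theorem isAddHaarMeasure_inv_smul_and_apply_eq_one :
    ((μ (adeleFundamentalDomain K))⁻¹ • μ).IsAddHaarMeasure ∧
      ((μ (adeleFundamentalDomain K))⁻¹ • μ) (adeleFundamentalDomain K) = 1 := by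
  have h0 := measure_adeleFundamentalDomain_ne_zero μ
  have htop := (measure_adeleFundamentalDomain_lt_top K μ).ne
  refine ⟨IsAddHaarMeasure.smul μ (ENNReal.inv_ne_zero.2 htop) (ENNReal.inv_ne_top.2 h0), ?_⟩
  rw [Measure.smul_apply, smul_eq_mul, ENNReal.inv_mul_cancel h0 htop]

omit [BorelSpace (AdeleRing (𝓞 K) K)] [μ.IsAddHaarMeasure] in
/-- **`𝔉_{μ(D)⁻¹ μ} f = μ(D)⁻¹ • 𝔉_μ f`** (the Fourier transform scales with the measure).
[cite: CasselsFrohlichANT1967, Ch. XV Thm. 4.2.1] -/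
theorem adeleFourier_inv_smul (f : AdeleRing (𝓞 K) K → ℂ) :
    adeleFourier K ((μ (adeleFundamentalDomain K))⁻¹ • μ) f =
      ((μ (adeleFundamentalDomain K)).toReal⁻¹ : ℂ) • adeleFourier K μ f := by
  funext ξ
  unfold adeleFourier
  rw [Pi.smul_apply, integral_smul_measure, ENNReal.toReal_inv, Complex.real_smul, smul_eq_mul,
    Complex.ofReal_inv]

variable [MeasurableSpace (GaloisRepresentations.ideleGroup K)]
  [BorelSpace (GaloisRepresentations.ideleGroup K)]
  (ν : Measure (GaloisRepresentations.ideleGroup K)) [ν.IsHaarMeasure]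
  {𝓕 : Set (GaloisRepresentations.ideleGroup K)}

/-- **Rogawski's Lemma 7.1.1 (trivial character) for an ARBITRARY additive Haar measure `μ` on
`𝔸_K`**: with `c := μ(D)⁻¹` (`D = adeleFundamentalDomain K`), any Haar `ν` on `𝕀_K`, an idele class
domain `𝓕`, `f ∈ 𝒮(𝔸_K)` and `T > 0`, the function
`x ↦ (Σf(x) − ‖x‖⁻¹ 1_{‖x‖<T⁻¹} · c 𝔉_μ f(0)) ‖x‖` is `ν`-integrable on `𝓕` and its integral is
`V log T · c 𝔉_μ f(0) + (∫_{𝓕∩{‖x‖≥1}} Σf ‖x‖ dν + c ∫_{𝓕∩{‖x‖≥1}} Σ(𝔉_μ f) dν − V f(0))` — the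
self-dual statement ★ `integrableOn_and_setIntegral_tateTruncated` transported along
`𝔉_{c μ} = c 𝔉_μ`. [cite: Rogawski1990, §7.1 Lemma 7.1.1]
[cite: CasselsFrohlichANT1967, Ch. XV Thm. 4.4.1 (proof)] -/
theorem integrableOn_and_setIntegral_tateTruncated_haar (h𝓕 : IsIdeleClassDomain K 𝓕)
    {f : AdeleRing (𝓞 K) K → ℂ} (hf : f ∈ schwartzBruhatAdele K) {T : ℝ} (hT : 0 < T) :
    IntegrableOn (fun x => (ideleSum K f x - ((IdeleClassGroup.ideleNorm K x : ℝ) : ℂ)⁻¹ *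
        {x : GaloisRepresentations.ideleGroup K | (IdeleClassGroup.ideleNorm K x : ℝ) < T⁻¹}.indicator
          (fun _ => ((μ (adeleFundamentalDomain K)).toReal⁻¹ : ℂ) * adeleFourier K μ f 0) x) *
        ((IdeleClassGroup.ideleNorm K x : ℝ) : ℂ)) 𝓕 ν ∧
      ∫ x in 𝓕, (ideleSum K f x - ((IdeleClassGroup.ideleNorm K x : ℝ) : ℂ)⁻¹ *
          {x : GaloisRepresentations.ideleGroup K | (IdeleClassGroup.ideleNorm K x : ℝ) < T⁻¹}.indicator
            (fun _ => ((μ (adeleFundamentalDomain K)).toReal⁻¹ : ℂ) * adeleFourier K μ f 0) x) *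
          ((IdeleClassGroup.ideleNorm K x : ℝ) : ℂ) ∂ν =
        (((idelicCovolume K ν).toReal * Real.log T : ℝ) : ℂ) *
            (((μ (adeleFundamentalDomain K)).toReal⁻¹ : ℂ) * adeleFourier K μ f 0) +
          ((∫ x in {x | 1 ≤ (IdeleClassGroup.ideleNorm K x : ℝ)} ∩ 𝓕,
              ideleSum K f x * ((IdeleClassGroup.ideleNorm K x : ℝ) : ℂ) ∂ν) +
            ((μ (adeleFundamentalDomain K)).toReal⁻¹ : ℂ) *
              (∫ x in {x | 1 ≤ (IdeleClassGroup.ideleNorm K x : ℝ)} ∩ 𝓕,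
                ideleSum K (adeleFourier K μ f) x ∂ν) -
            ((idelicCovolume K ν).toReal : ℂ) * f 0) := by
  obtain ⟨hHaar, hone⟩ := isAddHaarMeasure_inv_smul_and_apply_eq_one μ
  haveI := hHaar
  set c : ℂ := ((μ (adeleFundamentalDomain K)).toReal⁻¹ : ℂ) with hc
  have hF : adeleFourier K ((μ (adeleFundamentalDomain K))⁻¹ • μ) f = c • adeleFourier K μ f :=
    adeleFourier_inv_smul μ f
  have hF0 : adeleFourier K ((μ (adeleFundamentalDomain K))⁻¹ • μ) f 0 = c * adeleFourier K μ f 0 := by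
    rw [hF, Pi.smul_apply, smul_eq_mul]
  have hS : ∀ x, ideleSum K (adeleFourier K ((μ (adeleFundamentalDomain K))⁻¹ • μ) f) x =
      c * ideleSum K (adeleFourier K μ f) x := fun x => by rw [hF, ideleSum_smul]
  have h := integrableOn_and_setIntegral_tateTruncated ((μ (adeleFundamentalDomain K))⁻¹ • μ) ν
    hone h𝓕 hf hT
  simp only [hF0, hS] at h
  rw [integral_const_mul] at h
  exact h

/-! ### ED. 2: the twisted lemma (Lemma 7.1.1 (a)) for an arbitrary Haar measure -/

/-- **Rogawski's Lemma 7.1.1 (a) (non-trivial character) for an ARBITRARY additive Haar measure `μ`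
on `𝔸_K`**: with `c := μ(D)⁻¹`, for `χ : 𝕀_K →* ℂ` measurable, `‖χ‖ ≤ 1`, trivial on `Kˣ` and
`χ(y₀) ≠ 1` for some norm-one `y₀`, the twisted truncated integrand
`x ↦ (Σf(x) − ‖x‖⁻¹ 1_{‖x‖<T⁻¹} · c 𝔉_μ f(0)) χ(x) ‖x‖` is integrable on `𝓕` with integral
`∫_{𝓕∩{‖x‖≥1}} Σf χ ‖x‖ dν + c ∫_{𝓕∩{‖x‖≥1}} Σ(𝔉_μ f)(x) χ(x⁻¹) dν` (no `T`, transported from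
★ `integrableOn_and_setIntegral_tateTruncated_twisted` along `𝔉_{cμ} = c 𝔉_μ`).
[cite: Rogawski1990, §7.1 Lemma 7.1.1] [cite: CasselsFrohlichANT1967, Ch. XV Thm. 4.4.1 (proof)] -/
theorem integrableOn_and_setIntegral_tateTruncated_twisted_haar (h𝓕 : IsIdeleClassDomain K 𝓕)
    {f : AdeleRing (𝓞 K) K → ℂ} (hf : f ∈ schwartzBruhatAdele K) {T : ℝ} (hT : 0 < T)
    (χ : GaloisRepresentations.ideleGroup K →* ℂ) (hχm : Measurable χ) (hχb : ∀ x, ‖χ x‖ ≤ 1)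
    (hχK : ∀ k ∈ GaloisRepresentations.principalIdeles K, χ k = 1)
    {y₀ : GaloisRepresentations.ideleGroup K} (hy₀ : IdeleClassGroup.ideleNorm K y₀ = 1)
    (hχy₀ : χ y₀ ≠ 1) :
    IntegrableOn (fun x => (ideleSum K f x - ((IdeleClassGroup.ideleNorm K x : ℝ) : ℂ)⁻¹ *
        {x : GaloisRepresentations.ideleGroup K | (IdeleClassGroup.ideleNorm K x : ℝ) < T⁻¹}.indicator
          (fun _ => ((μ (adeleFundamentalDomain K)).toReal⁻¹ : ℂ) * adeleFourier K μ f 0) x) * χ x *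
        ((IdeleClassGroup.ideleNorm K x : ℝ) : ℂ)) 𝓕 ν ∧
      ∫ x in 𝓕, (ideleSum K f x - ((IdeleClassGroup.ideleNorm K x : ℝ) : ℂ)⁻¹ *
          {x : GaloisRepresentations.ideleGroup K | (IdeleClassGroup.ideleNorm K x : ℝ) < T⁻¹}.indicator
            (fun _ => ((μ (adeleFundamentalDomain K)).toReal⁻¹ : ℂ) * adeleFourier K μ f 0) x) * χ x *
          ((IdeleClassGroup.ideleNorm K x : ℝ) : ℂ) ∂ν =
        (∫ x in {x | 1 ≤ (IdeleClassGroup.ideleNorm K x : ℝ)} ∩ 𝓕,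
            ideleSum K f x * χ x * ((IdeleClassGroup.ideleNorm K x : ℝ) : ℂ) ∂ν) +
          ((μ (adeleFundamentalDomain K)).toReal⁻¹ : ℂ) *
            ∫ x in {x | 1 ≤ (IdeleClassGroup.ideleNorm K x : ℝ)} ∩ 𝓕,
              ideleSum K (adeleFourier K μ f) x * χ x⁻¹ ∂ν := by
  obtain ⟨hHaar, hone⟩ := isAddHaarMeasure_inv_smul_and_apply_eq_one μ
  haveI := hHaar
  set c : ℂ := ((μ (adeleFundamentalDomain K)).toReal⁻¹ : ℂ) with hc
  have hF : adeleFourier K ((μ (adeleFundamentalDomain K))⁻¹ • μ) f = c • adeleFourier K μ f :=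
    adeleFourier_inv_smul μ f
  have hF0 : adeleFourier K ((μ (adeleFundamentalDomain K))⁻¹ • μ) f 0 = c * adeleFourier K μ f 0 := by
    rw [hF, Pi.smul_apply, smul_eq_mul]
  have hS : ∀ x, ideleSum K (adeleFourier K ((μ (adeleFundamentalDomain K))⁻¹ • μ) f) x =
      c * ideleSum K (adeleFourier K μ f) x := fun x => by rw [hF, ideleSum_smul]
  have h := integrableOn_and_setIntegral_tateTruncated_twisted ν ((μ (adeleFundamentalDomain K))⁻¹ • μ)
    hone h𝓕 hf hT χ hχm hχb hχK hy₀ hχy₀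
  simp only [hF0, hS] at h
  have hmul : ∀ x, c * ideleSum K (adeleFourier K μ f) x * χ x⁻¹ =
      c * (ideleSum K (adeleFourier K μ f) x * χ x⁻¹) := fun x => mul_assoc _ _ _
  simp only [hmul] at h
  rw [integral_const_mul] at h
  exact h

end Literature.NumberTheory.Automorphic
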